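import Mathlib
import Literature.AlgebraicGeometry.Ramification.InertiaNormalSylow
import Literature.AlgebraicGeometry.Resolution.ResolutionOfSingularities
import HarnessLib

/-!
# KollarSzaboGoingDown

Topic `Literature/AlgebraicGeometry/GroupActions`. Named literature fact(s) relocated by the gate from `Summits/ResolutionOfSingularities/ResolutionOfSingularities/Theorems/WildQuotientsWildQuotientResolutionPrimeOrbitSeparationUnreachable.lean`
(accept-time relocation of `[cite]`d propositions written inline in a Summits proposal; human ruling 2026-08-15).
Sources: ReichsteinYoussin2000.

* `Literature.AlgebraicGeometry.GroupActions.KollarSzaboGoingDown`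
-/

namespace Literature.AlgebraicGeometry.GroupActions

open CategoryTheory AlgebraicGeometry TopologicalSpace IsLocalRing
open Literature.AlgebraicGeometry.Resolution Literature.AlgebraicGeometry.Ramification
open scoped IsMulCommutative

/-- **Kollár–Szabó, «going down» (special case: the inverse of a proper birational equivariant morphism, finite
abelian group).** Over an algebraically closed field `K`: let a finite abelian group `H` act by `K`-automorphisms on
integral `K`-schemes `X` (separated, of finite type) and `Y` (PROPER over `K`), compatibly with a birational
`K`-morphism `π : Y → X`. If `H` fixes a closed point `x ∈ X` at which `X` is regular (`H ≤ I_x`), then `H` fixes a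
point of `Y` (`H ≤ I_y` for some `y`). The source proves it for any `H`-equivariant RATIONAL map `X ⇢ Y` with `Y` proper
and any linear algebraic group `H` whose representations all have an eigenvector (every finite abelian group
qualifies: commuting matrices over an algebraically closed field share an eigenvector), by induction on `dim X` via the
blow-up of `x`. [cite: ReichsteinYoussin2000, Appendix (J. Kollár–E. Szabó), Prop. A.2 «Going down»; arXiv:math/9903162
§10, Prop. 10.2] [file AlgebraicGeometry/GroupActions/KollarSzaboGoingDown]
-- TODO(general form): `H`-equivariant rational maps `X ⇢ Y`; `H` any linear algebraic group with a normal unipotent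
-- subgroup and abelian quotient (Lemma A.1); the fixed point on `Y` is a closed point. -/
def KollarSzaboGoingDown : Prop :=
  ∀ (K : Type) [Field K] [IsAlgClosed K] (X Y : AlgebraicGeometry.Scheme.{0})
    (sX : X ⟶ AlgebraicGeometry.Spec (CommRingCat.of K)) [AlgebraicGeometry.IsSeparated sX]
    [AlgebraicGeometry.LocallyOfFiniteType sX] [AlgebraicGeometry.QuasiCompact sX]
    [AlgebraicGeometry.IsIntegral X] [AlgebraicGeometry.IsIntegral Y] (π : Y ⟶ X)
    [AlgebraicGeometry.IsProper (CategoryTheory.CategoryStruct.comp π sX)],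
    Literature.AlgebraicGeometry.Resolution.IsBirational π →
    ∀ (H : Type) [CommGroup H] [Finite H] (σ : H →* CategoryTheory.Aut X) (τ : H →* CategoryTheory.Aut Y),
      (∀ h : H, CategoryTheory.CategoryStruct.comp (σ h).hom sX = sX) →
      (∀ h : H, CategoryTheory.CategoryStruct.comp (τ h).hom π = CategoryTheory.CategoryStruct.comp π (σ h).hom) →
      ∀ x : X, IsClosed ({x} : Set X) → IsRegularLocalRing (X.presheaf.stalk x) →
        (∀ h : H, h ∈ Literature.AlgebraicGeometry.Ramification.inertiaSubgroup σ x) →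
        ∃ y : Y, ∀ h : H, h ∈ Literature.AlgebraicGeometry.Ramification.inertiaSubgroup τ y

end Literature.AlgebraicGeometry.GroupActions
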